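import Literature.Geometry.Kaehler.ComplexTorusAbelianDivisorClass
import HarnessLib

/-!
# The degree of an elliptic curve on a polarized complex torus is positive; the sign in Auffarth's Theorem 1.1
# (Auffarth 2015, §2: `deg D := (D · Θ^{n−1})`, Thm. 2.10 "`deg α > 0`"; Kani 1994 for surfaces — torus level)

Layer `Literature/Geometry/Kaehler`, namespace `Literature.Geometry.Kaehler.ComplexTorus`; lane `lit-hodgefound`
(Track 2 foundations library, Layer A4), row **A4-61** (seat skel-4), FILE 2. Sequel of FILE 1
(`ComplexTorusAbelianDivisorClass`: the class `[Y]` of an abelian divisor is primitive and determines `Y`; on a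
complex `2`-torus the primitive classes of square zero are `±[Y]`), supplying the SIGN that FILE 1 left open.

## Source, VERBATIM

R. Auffarth, *Elliptic curves on abelian varieties*, Illinois J. Math. **59** (2015)
[Auffarth2015EllipticCurvesAbelianVarieties; open copy `paper:arxiv-1507.08617`], §2 (p0006):

> We define the degree of a divisor `D` on `A` to be `deg D := (D · Θ^{n−1})`. In the same way we define the degree
> of an algebraic class. The degree of a curve `C` on `A` is defined analogously as `deg C := (C · Θ)`.
> **Theorem 2.10.** Let `A` be an abelian variety of dimension `n`. Then the map `Z ↦ [Z]` induces a bijective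
> correspondence between abelian divisors on `A` and primitive elements `α ∈ NS(A)` that satisfy `α² = 0` in
> `𝔄^*(A)` and `deg α > 0`.

(= Thm. 1.1 of the Introduction, p0003, with `(α · Θ^{n−1}) > 0`.)

## Torus-level reading; the tree's sign convention

For an elliptic curve `Y ⊂ X = E/Φ(ℤ^ι)` — a `SubtorusFrame Φ 2`, i.e. a saturated, positively oriented `ℤ`-basis
`λ′₀, λ′₁` of `Λ ∩ T_Y` for the complex structure of the line `T_Y` (any ambient dimension) — and an invariant
`2`-form `ω`, row A4-18 gives `∫_X ω ∧ [Y] = ω(Φλ′₀, Φλ′₁) = ∫_Y ω|_Y` (`SubtorusFrame.torusIntegral_wedge_cycleForm`).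
A polarization is a Riemann form `E = Im H` (`IsRiemannForm`: type `(1,1)`, integral, `H(u, u) = E(iu, u) > 0`), and
the tree's first Chern form of `L = L(H, χ)` is the invariant form `−E` (row A4-16, Chern–Weil for the canonical
factor). Hence

  `deg_L(Y) = (Y · c₁(L)) = ∫_X c₁(L) ∧ [Y] = −E(Φλ′₀, Φλ′₁) > 0`, i.e. **`E(Φλ′₀, Φλ′₁) < 0`**

(`SubtorusFrame.apply_frame_neg`; proof: `T_Y` is a complex LINE, `Φλ′₁ = a Φλ′₀ + b · iΦλ′₀` with `b > 0` by the
positive orientation, and `E(u, iu) = −H(u, u) < 0`). Consequently (§3, `g = 2`, with FILE 1): among `±[Y]` exactly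
`[Y]` has positive degree, and **Theorem 1.1 / 2.10 for abelian surfaces** holds at torus level with "`deg γ > 0`"
read as `Re ∫_X E_ℂ ∧ γ < 0` for a (any) polarization `E`: `exists_cycleForm_eq_of_primitive_of_deg`; with FILE 1's
`eq_of_cycleForm_ofSubspace_eq` (injectivity) and `cycleForm_ofSubspace_mem_and_primitive_and_wedge_self` this is
the full bijection `Y ↦ [Y]` between elliptic curves on the complex `2`-torus `X` and primitive classes
`γ ∈ H²(X, ℤ) ∩ H^{1,1}(X)` with `γ ∧ γ = 0` and `deg γ > 0`.

## Contents (theorems only; no definition, no named fact)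

* §1 `apply_neg_of_isPosOriented` — a real `2`-form with `E(iu, u) > 0` on a complex line `K` is NEGATIVE on every
  positively oriented real basis of `K`.
* §2 **`SubtorusFrame.apply_frame_neg`** (`E(Φλ′₀, Φλ′₁) < 0` for every elliptic curve and every form positive on
  its tangent line), **`IsRiemannForm.apply_frame_neg`**, `SubtorusFrame.torusIntegral_ofRealForm_wedge_cycleForm`
  (`∫_X E_ℂ ∧ [Y] = E(Φλ′₀, Φλ′₁)`), **`IsRiemannForm.re_torusIntegral_wedge_cycleForm_neg`** (`deg_L Y > 0` in the
  tree's sign), `IsRiemannForm.re_torusIntegral_wedge_neg_cycleForm_pos` (`−[Y]` has the opposite sign).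
* §3 (`g = 2`) **`exists_cycleForm_eq_of_primitive_of_deg`** (Thm. 1.1 / 2.10: a primitive integral Hodge class with
  `γ ∧ γ = 0` and `deg γ > 0` IS the class `[Y]` of an elliptic curve, on the nose).

## References

* [Auffarth2015EllipticCurvesAbelianVarieties] R. Auffarth, *Elliptic curves on abelian varieties*, Illinois J.
  Math. 59 (2015) 271–279; arXiv:1507.08617 — §2 (degree), Thm. 2.10, Thm. 1.1.
* [Kani1994EllipticCurvesAbelianSurfaces] E. Kani, *Elliptic curves on abelian surfaces*, Manuscripta Math. 84 (1994)
  199–223 (surfaces; not held).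
* [VoisinHodgeI2002] C. Voisin, *Hodge Theory and Complex Algebraic Geometry I*, CUP (2002), §11.1.2 Cor. 11.15
  (complex orientations; `∫_X ω ∧ [Z] = ∫_Z ω`).
* [LangeBirkenhake1992] H. Lange, Ch. Birkenhake, *Complex Abelian Varieties* (1992), Lemma 2.1.7 / §4.1 (Riemann
  forms, `H > 0`).
-/

noncomputable section

set_option maxSynthPendingDepth 3

open Module Function Complex Matrix

namespace Literature.Geometry.Kaehler

namespace ComplexTorus

/-! ## §1 A form with `E(iu, u) > 0` is negative on positively oriented bases of a complex line -/

section Line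

variable {E : Type*} [NormedAddCommGroup E] [NormedSpace ℂ E]

/-- On `Fin (1 · 2)` the second component of `finProdFinEquiv.symm` (the slot of `(b₀, i b₀)`) is the index itself.
[folklore] -/
private theorem finProdFinEquiv_symm_snd (h : 1 * 2 = 2) (i : Fin 2) :
    (finProdFinEquiv.symm ((finCongr h).symm i)).2 = i := by
  apply Fin.ext
  simp only [finProdFinEquiv_symm_apply, Fin.coe_modNat, finCongr_symm, finCongr_apply_coe]
  exact Nat.mod_eq_of_lt i.2

/-- **A real `2`-form `η` with `η(iu, u) > 0` on a complex line `K ⊆ E` is negative on every positively oriented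
real basis `(v₀, v₁)` of `K`**: in the real basis `(v₀, i v₀)` one has `v₁ = a v₀ + b · i v₀` with `b = det > 0`, and
`η(v₀, i v₀) = −η(i v₀, v₀) < 0`.
[cite: VoisinHodgeI2002, §11.1.2 Cor. 11.15 (complex orientations)] [cite: LangeBirkenhake1992, Lemma 2.1.7 (`H(u,u) = E(iu,u) > 0`)] -/
theorem apply_neg_of_isPosOriented {K : Submodule ℂ E} (η : E [⋀^Fin 2]→L[ℝ] ℝ)
    (hpos : ∀ u : E, u ∈ K → u ≠ 0 → 0 < η ![I • u, u]) {v : Fin 2 → K} (hv : IsPosOriented v) :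
    η ![(v 0 : E), (v 1 : E)] < 0 := by
  classical
  have hli := hv.linearIndependent
  obtain ⟨q, h, b, -⟩ := id hv
  obtain rfl : q = 1 := by omega
  have hK : finrank ℂ K = 1 := by rw [finrank_eq_card_basis b, Fintype.card_fin]
  have hv0 : v 0 ≠ 0 := hli.ne_zero 0
  have hv0E : (v 0 : E) ≠ 0 := fun h0 ↦ hv0 (Subtype.ext h0)
  -- the complex basis `b′ = (v₀)` of the line `K` and its real basis `R = (v₀, i v₀)`
  obtain ⟨b', hb'⟩ : ∃ b' : Basis (Fin 1) ℂ K, ∀ j, b' j = v 0 :=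
    ⟨FiniteDimensional.basisSingleton (Fin 1) hK (v 0) hv0, FiniteDimensional.basisSingleton_apply _ _ _ _⟩
  obtain ⟨R, hRdef⟩ : ∃ R : Basis (Fin 2) ℝ K, R = (realBasisOfComplex b').reindex (finCongr h) := ⟨_, rfl⟩
  have hRi : ∀ i : Fin 2, R i = (Complex.basisOneI i : ℂ) • v 0 := fun i ↦ by
    rw [hRdef, Basis.reindex_apply, realBasisOfComplex_apply, hb', finProdFinEquiv_symm_snd h i]
  have hR0 : R 0 = v 0 := by rw [hRi, Complex.coe_basisOneI, Matrix.cons_val_zero, one_smul]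
  have hR1 : R 1 = I • v 0 := by
    rw [hRi, Complex.coe_basisOneI]
    simp
  -- positive orientation read in `R`: the `i v₀`-coordinate of `v₁` is positive
  have hdet : 0 < R.det v := by rw [hRdef]; exact (isPosOriented_iff h b' v).1 hv
  have hrepr0 : R.repr (v 0) = Finsupp.single 0 1 := by rw [← hR0, R.repr_self]
  have hdet' : R.det v = R.repr (v 1) 1 := by
    rw [Basis.det_apply, Matrix.det_fin_two]
    simp [Basis.toMatrix_apply, hrepr0]
  have hc1 : 0 < R.repr (v 1) 1 := hdet' ▸ hdet
  -- `v₁ = a v₀ + b (i v₀)` and `η(v₀, v₁) = b η(v₀, i v₀) = −b η(i v₀, v₀) < 0`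
  have hv1 : (v 1 : E) = R.repr (v 1) 0 • (v 0 : E) + R.repr (v 1) 1 • (I • (v 0 : E)) := by
    have hs := R.sum_repr (v 1)
    rw [Fin.sum_univ_two, hR0, hR1] at hs
    have hs' := congrArg (Subtype.val : K → E) hs
    simpa using hs'.symm
  rw [hv1, twoForm_add_right, twoForm_smul_right, twoForm_smul_right, twoForm_self, mul_zero, zero_add,
    twoForm_swap η (v 0 : E) (I • (v 0 : E))]
  have hH := hpos (v 0 : E) (v 0).2 hv0E
  nlinarith

end Line

/-! ## §2 `E(Φλ′₀, Φλ′₁) < 0` for elliptic curves; `deg_L(Y) = ∫_X c₁(L) ∧ [Y] > 0` -/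

section Frame

variable {ι : Type*} [Fintype ι] [DecidableEq ι] {E : Type*} [NormedAddCommGroup E] [NormedSpace ℂ E]
  (Φ : (ι → ℝ) ≃L[ℝ] E)

omit [Fintype ι] [DecidableEq ι] in
/-- **A form positive on the tangent line of an elliptic curve is negative on its oriented lattice frame**: for a
`SubtorusFrame Φ 2` (an elliptic curve `Y ⊂ X` with its positively oriented saturated frame `λ′₀, λ′₁`) and a real
`2`-form `η` with `η(iu, u) > 0` for `0 ≠ u ∈ T_Y`, `η(Φλ′₀, Φλ′₁) < 0`.
[cite: Auffarth2015EllipticCurvesAbelianVarieties, §2 (`deg C := (C · Θ)`) and Thm. 2.10 (`deg α > 0`)] [cite: VoisinHodgeI2002, §11.1.2 Cor. 11.15] -/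
theorem SubtorusFrame.apply_frame_neg (Z : SubtorusFrame Φ 2) (η : E [⋀^Fin 2]→L[ℝ] ℝ)
    (hpos : ∀ u : E, u ∈ frameSpan Φ Z.frame → u ≠ 0 → 0 < η ![I • u, u]) :
    η ![latticeVec Φ (Z.frame 0), latticeVec Φ (Z.frame 1)] < 0 := by
  have h := apply_neg_of_isPosOriented η hpos Z.posOriented
  simpa only [coe_frameInSpan, latticeTuple_apply] using h

omit [Fintype ι] [DecidableEq ι] in
/-- **A Riemann form is negative on the oriented lattice frame of every elliptic curve** (`H > 0` everywhere).
[cite: Auffarth2015EllipticCurvesAbelianVarieties, §2 Thm. 2.10 (`deg α > 0`)] [cite: LangeBirkenhake1992, Lemma 2.1.7 and §4.1] -/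
theorem IsRiemannForm.apply_frame_neg {η : E [⋀^Fin 2]→L[ℝ] ℝ} (hη : IsRiemannForm Φ η) (Z : SubtorusFrame Φ 2) :
    η ![latticeVec Φ (Z.frame 0), latticeVec Φ (Z.frame 1)] < 0 :=
  Z.apply_frame_neg Φ η fun u _ hu ↦ hη.2.2 u hu

/-- **`∫_X E_ℂ ∧ [Y] = E(Φλ′₀, Φλ′₁)`** for an elliptic curve `Y` and a real `2`-form `E` (row A4-18's
`∫_X ω ∧ [Z] = ω(Φu)`). [cite: VoisinHodgeI2002, §11.1.2 Cor. 11.15 (eq. (11.5))] -/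
theorem SubtorusFrame.torusIntegral_ofRealForm_wedge_cycleForm {k : ℕ} (Z : SubtorusFrame Φ 2) (e : Fin (2 + k) ≃ ι)
    (η : E [⋀^Fin 2]→L[ℝ] ℝ) :
    torusIntegral Φ e ((ofRealForm η).wedge (Z.cycleForm e)) =
      ((η ![latticeVec Φ (Z.frame 0), latticeVec Φ (Z.frame 1)] : ℝ) : ℂ) := by
  rw [Z.torusIntegral_wedge_cycleForm e (ofRealForm η), ofRealForm_apply]
  congr 2
  funext j
  fin_cases j <;> rfl

/-- **The degree of an elliptic curve with respect to a polarization is positive**, in the tree's sign convention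
`c₁(L) = −E`: `Re ∫_X E_ℂ ∧ [Y] = E(Φλ′₀, Φλ′₁) < 0`, i.e. `deg_L(Y) = ∫_X c₁(L) ∧ [Y] > 0`.
[cite: Auffarth2015EllipticCurvesAbelianVarieties, §2 (`deg C := (C · Θ)`) and Thm. 2.10 (`deg α > 0`)] -/
theorem IsRiemannForm.re_torusIntegral_wedge_cycleForm_neg {k : ℕ} {η : E [⋀^Fin 2]→L[ℝ] ℝ} (hη : IsRiemannForm Φ η)
    (Z : SubtorusFrame Φ 2) (e : Fin (2 + k) ≃ ι) :
    (torusIntegral Φ e ((ofRealForm η).wedge (Z.cycleForm e))).re < 0 := by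
  rw [Z.torusIntegral_ofRealForm_wedge_cycleForm Φ e η, Complex.ofReal_re]
  exact hη.apply_frame_neg Φ Z

/-- … while the opposite class `−[Y]` has the opposite sign: `Re ∫_X E_ℂ ∧ (−[Y]) > 0`.
[cite: Auffarth2015EllipticCurvesAbelianVarieties, §2 Thm. 2.10 (`deg α > 0`)] -/
theorem IsRiemannForm.re_torusIntegral_wedge_neg_cycleForm_pos {k : ℕ} {η : E [⋀^Fin 2]→L[ℝ] ℝ}
    (hη : IsRiemannForm Φ η) (Z : SubtorusFrame Φ 2) (e : Fin (2 + k) ≃ ι) :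
    0 < (torusIntegral Φ e ((ofRealForm η).wedge (-(Z.cycleForm e)))).re := by
  have h0 : (ofRealForm η).wedge (0 : E [⋀^Fin k]→L[ℝ] ℂ) = 0 := by
    ext v
    simp
  rw [show -(Z.cycleForm e) = 0 - Z.cycleForm e from (zero_sub _).symm, wedge_sub_right, h0, torusIntegral_sub,
    torusIntegral_zero, zero_sub, Complex.neg_re]
  exact neg_pos.2 (hη.re_torusIntegral_wedge_cycleForm_neg Φ Z e)

end Frame

/-! ## §3 Abelian surfaces: Theorem 1.1 / 2.10 with the sign -/

section Surface

variable {ι : Type*} [Fintype ι] [DecidableEq ι] {E : Type*} [NormedAddCommGroup E] [NormedSpace ℂ E]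
  (Φ : (ι → ℝ) ≃L[ℝ] E)

/-- **Theorem 1.1 / 2.10 for abelian surfaces at torus level, with the sign (Kani; Auffarth): a PRIMITIVE integral
Hodge class `γ ∈ H²(X, ℤ) ∩ H^{1,1}(X)` on a complex `2`-torus with `γ ∧ γ = 0` and POSITIVE DEGREE with respect to
a polarization `E` (`Re ∫_X E_ℂ ∧ γ < 0`, the tree's `c₁(L) = −E`) is the class `[Y]` of an elliptic curve `Y ⊂ X`**
— on the nose, not only up to sign (FILE 1 `exists_cycleForm_of_primitive_of_wedge_self_eq_zero` gives `±[Y]`;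
`−[Y]` has negative degree, §2). With FILE 1's `eq_of_cycleForm_ofSubspace_eq` the curve is unique, and conversely
every `[Y]` is such a class (`cycleForm_ofSubspace_mem_and_primitive_and_wedge_self`,
`IsRiemannForm.re_torusIntegral_wedge_cycleForm_neg`): the bijection of Theorem 1.1 for `n = 2`.
[cite: Auffarth2015EllipticCurvesAbelianVarieties, §1 Thm. 1.1 and §2 Thm. 2.10] [cite: Kani1994EllipticCurvesAbelianSurfaces, (surfaces)] -/
theorem exists_cycleForm_eq_of_primitive_of_deg [FiniteDimensional ℂ E] (h2 : finrank ℂ E = 2)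
    (e : Fin (2 + 2) ≃ ι) {η₀ : E [⋀^Fin 2]→L[ℝ] ℝ} (hη₀ : IsRiemannForm Φ η₀) {γ : E [⋀^Fin 2]→L[ℝ] ℂ}
    (hγ : γ ∈ integralHodgeClasses Φ 1)
    (hprim : ∀ (k : ℤ) (β : E [⋀^Fin 2]→L[ℝ] ℂ), β ∈ integralForms Φ 2 → (k : ℂ) • β = γ → k = 1 ∨ k = -1)
    (hγγ : γ.wedge γ = 0) (hdeg : (torusIntegral Φ e ((ofRealForm η₀).wedge γ)).re < 0) :
    ∃ (W : Submodule ℝ (ι → ℝ)) (hW : IsLatticeSubspace W) (hWc : IsComplexSubspace Φ W)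
      (eY : Fin 2 ≃ Fin (subRank W)) (hpos : orientationSign (subtorusPeriod Φ W hW hWc) eY = 1),
      W ≠ ⊥ ∧ W ≠ ⊤ ∧ γ = (SubtorusFrame.ofSubspace Φ W hW hWc eY hpos).cycleForm e := by
  obtain ⟨W, hW, hWc, eY, hpos, hb, ht, h⟩ :=
    exists_cycleForm_of_primitive_of_wedge_self_eq_zero Φ h2 e hγ hprim hγγ
  refine ⟨W, hW, hWc, eY, hpos, hb, ht, ?_⟩
  rcases h with h | h
  · exact h
  · exfalso
    have hp := hη₀.re_torusIntegral_wedge_neg_cycleForm_pos Φ (SubtorusFrame.ofSubspace Φ W hW hWc eY hpos) e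
    rw [← h] at hp
    exact lt_asymm hdeg hp

end Surface

end ComplexTorus

end Literature.Geometry.Kaehler
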